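import Mathlib.MeasureTheory.Integral.Prod
import Literature.Probability.LatticeModels.PlaneRotatorGinibreComparison
import Literature.Probability.LatticeModels.TorusCharacterExpansion
import Literature.Combinatorics.Digraph.LiebOrientationCount
import HarnessLib

/-!
# Lieb's inequality for plane rotators, I: the duplicated system and the expansion of its Gibbs weight

E. H. Lieb, *A refinement of Simon's correlation inequality*, Comm. Math. Phys. **77** (1980) 127–135 [Lieb1980],
p. 132–133 (plane rotors), with V. Rivasseau, Comm. Math. Phys. **77** (1980) 145–147 [Rivasseau1980]. To prove
(23), `⟨cos(θ_a − θ_c)⟩_{A+C} ≤ ∑_{b ∈ A ∩ C} ⟨cos(θ_a − θ_b)⟩_A ⟨cos(θ_b − θ_c)⟩_{A+C}`, one clears denominators: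
`Z_A · (cos_{ac})_{A+C} ≤ ∑_b (cos_{ab})_A (cos_{bc})_{A+C}` for the unnormalised expectations, and both sides are
integrals over the DUPLICATED torus `(θ', θ) ∈ U(1)^V × U(1)^V` against `exp H_tot`,
`H_tot(θ', θ) = H_A(θ') + H_A(θ) + H_C(θ) = ∑_i J_i φ_i` summed over LABELLED bonds `i ∈ (V × V) ⊕ (V × V)`
(inside bonds `inl p` act on both copies, `φ = cos_p(θ') + cos_p(θ)`; `C`-bonds `inr p` on `θ` only). This file:

* the duplicated system (`bondPair`, `leftCos`, `dupCos`, `dupHam`) and the identity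
  `e^{−H_A(θ')} e^{−H_{A+C}(θ)} = exp H_tot` (`ginibreWeight_mul_ginibreWeight_eq_exp_dupHam`);
* `H_tot^N = ∑_g ∏_j J_{g j} ∏_j φ_{g j}` over words `g : Fin N → bonds` (`dupHam_pow_eq_sum`, `Finset.sum_pow'`);
* the splitting `∏_j φ_{g j} = ∑_{S ⊆ insidePos g} ∏_{j ∈ S} cos_{g j}(θ') ∏_{j ∉ S} cos_{g j}(θ)` (`prod_dupCos_eq_sum`,
  `Finset.prod_add`; `S` = the inside factors assigned to `Z_A`, Lieb's (12));
* **the coefficient inequality for one word** (`integral_obs_prod_dupCos_le`): for a word whose inside bonds lie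
  in `A × A` and whose `C`-bonds lie in `C × C`,
  `∫∫ cos(θ_a − θ_c) ∏_j φ_{g j} ≤ ∫∫ ∑_{b ∈ A∩C} cos(θ'_a − θ'_b) cos(θ_b − θ_c) ∏_j φ_{g j}` — by the counting
  formula `integral_cosDiff_mul_prod_cosDiff` each side is `2^{−N}` times a sum of products of orientation counts,
  and the comparison is `Literature.Combinatorics.Digraph.lieb_orientation_count_le` (Rivasseau's lemma).

The limit `exp = lim ∑_{N<L} H_tot^N/N!` and the assembly of (23) are in `PlaneRotatorLiebRivasseauProof.lean`.
-/

noncomputable section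

open MeasureTheory Filter Finset
open scoped Topology BigOperators

namespace Literature.Probability.LatticeModels

namespace PlaneRotator

open Literature.Combinatorics.Digraph

/-! ### The duplicated system `(θ', θ)` with labelled bonds -/

section Duplicated

variable {V : Type*}

/-- The underlying pair of a labelled bond (label `inl` = bond of the inside system `A`, `inr` = bond of `C`).
[cite: Lieb1980, eq. (4) (H_{A+C} = H_A + H_C)] -/
def bondPair (i : (V × V) ⊕ (V × V)) : V × V :=
  Sum.elim id id i

/-- The `θ'`-part of the interaction of a labelled bond in the duplicated system: inside bonds also act on the
second copy `θ'` (the copy carrying `Z_A`), `C`-bonds do not. [cite: Lieb1980, eq. (12) (the factor Z_A)] -/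
def leftCos : (V × V) ⊕ (V × V) → (V → Circle) → ℝ
  | Sum.inl p, θ => cosDiff p.1 p.2 θ
  | Sum.inr _, _ => 0

/-- The interaction `φ_i(θ', θ)` of a labelled bond in the duplicated system: `cos(θ') + cos(θ)` for an inside bond,
`cos(θ)` for a `C`-bond. [cite: Lieb1980, eqs. (4), (12)] -/
def dupCos (i : (V × V) ⊕ (V × V)) (z : (V → Circle) × (V → Circle)) : ℝ :=
  leftCos i z.1 + cosDiff (bondPair i).1 (bondPair i).2 z.2

/-- `|φ_i| ≤ 2`. [cite: Lieb1980, eqs. (4), (12)] -/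
theorem abs_dupCos_le (i : (V × V) ⊕ (V × V)) (z : (V → Circle) × (V → Circle)) : |dupCos i z| ≤ 2 := by
  unfold dupCos
  refine (abs_add_le _ _).trans ?_
  have h2 := abs_cosDiff_le_one (bondPair i).1 (bondPair i).2 z.2
  rcases i with p | p
  · have h1 := abs_cosDiff_le_one p.1 p.2 z.1
    simp only [leftCos] at h1 ⊢
    linarith
  · simp only [leftCos, abs_zero]
    linarith

/-- `φ_i` is continuous. [cite: Lieb1980, eqs. (4), (12)] -/
theorem continuous_dupCos (i : (V × V) ⊕ (V × V)) : Continuous (dupCos i : (V → Circle) × (V → Circle) → ℝ) := by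
  unfold dupCos
  refine Continuous.add ?_ ((continuous_cosDiff _ _).comp continuous_snd)
  rcases i with p | p
  · exact (continuous_cosDiff p.1 p.2).comp continuous_fst
  · exact continuous_const

variable [Fintype V]

/-- The total Hamiltonian `H_A(θ') + H_A(θ) + H_C(θ) = ∑_i J_i φ_i(θ', θ)` of the duplicated system.
[cite: Lieb1980, eqs. (4), (12)] -/
def dupHam (JA JC : V × V → ℝ) (z : (V → Circle) × (V → Circle)) : ℝ :=
  ∑ i, Sum.elim JA JC i * dupCos i z

/-- `|H_tot| ≤ 2 ∑_i |J_i|`. [cite: Lieb1980, eqs. (4), (12)] -/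
theorem abs_dupHam_le (JA JC : V × V → ℝ) (z : (V → Circle) × (V → Circle)) :
    |dupHam JA JC z| ≤ ∑ i, |Sum.elim JA JC i| * 2 := by
  unfold dupHam
  refine (Finset.abs_sum_le_sum_abs _ _).trans (Finset.sum_le_sum fun i _ => ?_)
  rw [abs_mul]
  exact mul_le_mul_of_nonneg_left (abs_dupCos_le i z) (abs_nonneg _)

/-- `H_tot` is continuous. [cite: Lieb1980, eqs. (4), (12)] -/
theorem continuous_dupHam (JA JC : V × V → ℝ) : Continuous (dupHam JA JC : (V → Circle) × (V → Circle) → ℝ) := by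
  unfold dupHam
  exact continuous_finsetSum _ fun i _ => continuous_const.mul (continuous_dupCos i)

/-- The Gibbs weight in the `cosDiff` vocabulary: `exp(∑_p J(p) cos(θ_{p.2} − θ_{p.1}))`. [cite: Lieb1980, p. 132 (plane rotor interactions)] -/
theorem ginibreWeight_pairChars_eq (J : V × V → ℝ) (θ : V → Circle) :
    ginibreWeight (pairChars V) J θ = Real.exp (∑ p, J p * cosDiff p.1 p.2 θ) := by
  unfold ginibreWeight ginibreHamiltonian
  congr 1
  exact Finset.sum_congr rfl fun p _ => by rw [pairChars_apply, cosDiff_eq_reChar]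

/-- **Duplication identity**: `e^{−H_A(θ')} · e^{−H_{A+C}(θ)} = exp H_tot(θ', θ)`. [cite: Lieb1980, eq. (12)] -/
theorem ginibreWeight_mul_ginibreWeight_eq_exp_dupHam (JA JC : V × V → ℝ) (z : (V → Circle) × (V → Circle)) :
    ginibreWeight (pairChars V) JA z.1 * ginibreWeight (pairChars V) (JA + JC) z.2 =
      Real.exp (dupHam JA JC z) := by
  rw [ginibreWeight_pairChars_eq, ginibreWeight_pairChars_eq, ← Real.exp_add]
  congr 1
  unfold dupHam
  rw [Fintype.sum_sum_type]
  simp only [Sum.elim_inl, Sum.elim_inr, dupCos, leftCos, bondPair, id, Pi.add_apply, zero_add, mul_add,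
    add_mul, Finset.sum_add_distrib]
  ring

end Duplicated

/-! ### Expansion of the powers of `H_tot` -/

section Expansion

variable {V : Type*} {N : ℕ}

/-- `H_tot^N = ∑_g (∏_j J_{g j}) ∏_j φ_{g j}`, the sum over words `g : Fin N → bonds`. [cite: Lieb1980, p. 133 (power series in β)] -/
theorem dupHam_pow_eq_sum [Fintype V] (JA JC : V × V → ℝ) (z : (V → Circle) × (V → Circle)) (N : ℕ) :
    dupHam JA JC z ^ N =
      ∑ g : Fin N → (V × V) ⊕ (V × V), (∏ j, Sum.elim JA JC (g j)) * ∏ j, dupCos (g j) z := by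
  unfold dupHam
  rw [Finset.sum_pow', Fintype.piFinset_univ]
  exact Finset.sum_congr rfl fun g _ => Finset.prod_mul_distrib

/-- The positions of a word carrying INSIDE bonds. [cite: Lieb1980, eq. (12) (the A-factors)] -/
def insidePos (g : Fin N → (V × V) ⊕ (V × V)) : Finset (Fin N) :=
  Finset.univ.filter fun j => (g j).isLeft

/-- **Splitting the inside factors between `Z_A` and `Z_{A+C}`**:
`∏_j φ_{g j}(θ', θ) = ∑_{S ⊆ insidePos g} ∏_{j ∈ S} cos_{g j}(θ') · ∏_{j ∉ S} cos_{g j}(θ)`.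
[cite: Lieb1980, eq. (12) (the two A-expectations)] -/
theorem prod_dupCos_eq_sum (g : Fin N → (V × V) ⊕ (V × V)) (z : (V → Circle) × (V → Circle)) :
    ∏ j, dupCos (g j) z =
      ∑ S ∈ (insidePos g).powerset,
        (∏ j ∈ S, cosDiff (bondPair (g j)).1 (bondPair (g j)).2 z.1) *
          ∏ j ∈ Finset.univ \ S, cosDiff (bondPair (g j)).1 (bondPair (g j)).2 z.2 := by
  unfold dupCos
  rw [Finset.prod_add, ← Finset.sum_subset (Finset.powerset_mono.2 (Finset.subset_univ (insidePos g)))]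
  · refine Finset.sum_congr rfl fun S hS => ?_
    congr 1
    refine Finset.prod_congr rfl fun j hj => ?_
    have hjA := Finset.mem_powerset.1 hS hj
    rw [insidePos, Finset.mem_filter] at hjA
    rcases h : g j with p | q
    · rfl
    · rw [h] at hjA
      simp at hjA
  · intro S _ hSn
    have hnot : ¬S ⊆ insidePos g := fun h => hSn (Finset.mem_powerset.2 h)
    obtain ⟨j, hjS, hjA⟩ := Finset.not_subset.1 hnot
    rw [Finset.prod_eq_zero hjS, zero_mul]
    rw [insidePos, Finset.mem_filter] at hjA
    rcases h : g j with p | q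
    · exact absurd ⟨Finset.mem_univ j, by rw [h]; rfl⟩ hjA
    · rfl

/-- Continuity of the split products. [folklore] -/
private theorem continuous_term (g : Fin N → (V × V) ⊕ (V × V)) (S : Finset (Fin N)) (x y x' y' : V) :
    Continuous fun z : (V → Circle) × (V → Circle) =>
      (cosDiff x y z.1 * ∏ j ∈ S, cosDiff (bondPair (g j)).1 (bondPair (g j)).2 z.1) *
        (cosDiff x' y' z.2 * ∏ j ∈ Finset.univ \ S, cosDiff (bondPair (g j)).1 (bondPair (g j)).2 z.2) :=
  (((continuous_cosDiff x y).comp continuous_fst).mul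
    (continuous_finsetProd _ fun _ _ => (continuous_cosDiff _ _).comp continuous_fst)).mul
    (((continuous_cosDiff x' y').comp continuous_snd).mul
      (continuous_finsetProd _ fun _ _ => (continuous_cosDiff _ _).comp continuous_snd))

variable [Fintype V] [MeasurableSpace Circle] [BorelSpace Circle]

/-- Integrability of continuous functions on the duplicated torus. [folklore] -/
private theorem integrable_dup {F : (V → Circle) × (V → Circle) → ℝ} (hF : Continuous F) :
    Integrable F ((torusHaar V).prod (torusHaar V)) :=
  integrable_of_continuous_of_isFiniteMeasure _ hF

variable [DecidableEq V]

/-- The number of orientations of the pairs at the positions of `S` with valence `e_x − e_y`. [cite: Lieb1980, p. 133 (the graphical exercise)] -/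
private abbrev cnt (g : Fin N → (V × V) ⊕ (V × V)) (S : Finset (Fin N)) (x y : V) : ℕ :=
  (Finset.univ.filter fun τ : S → Bool =>
    valence (orient (fun j : S => bondPair (g j)) τ) Finset.univ = Pi.single x 1 - Pi.single y 1).card

/-- The number of orientations of the pairs outside `S` with valence `e_x − e_y`. [cite: Lieb1980, p. 133 (the graphical exercise)] -/
private abbrev cntc (g : Fin N → (V × V) ⊕ (V × V)) (S : Finset (Fin N)) (x y : V) : ℕ :=
  (Finset.univ.filter fun τ : {j // j ∉ S} → Bool =>
    valence (orient (fun j : {j // j ∉ S} => bondPair (g j)) τ) Finset.univ = Pi.single x 1 - Pi.single y 1).card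

/-- A product of two two-point insertions against a split product of cosines integrates, over the duplicated
torus, to `2^{−N}` times a product of orientation counts. [cite: Lieb1980, p. 133 (the graphical exercise)] -/
private theorem integral_term_eq (g : Fin N → (V × V) ⊕ (V × V)) (S : Finset (Fin N)) (x y x' y' : V) :
    ∫ z, (cosDiff x y z.1 * ∏ j ∈ S, cosDiff (bondPair (g j)).1 (bondPair (g j)).2 z.1) *
        (cosDiff x' y' z.2 * ∏ j ∈ Finset.univ \ S, cosDiff (bondPair (g j)).1 (bondPair (g j)).2 z.2)
        ∂((torusHaar V).prod (torusHaar V)) =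
      ((cnt g S x y * cntc g S x' y' : ℕ) : ℝ) / 2 ^ N := by
  rw [integral_prod_mul (μ := torusHaar V) (ν := torusHaar V)
    (fun θ => cosDiff x y θ * ∏ j ∈ S, cosDiff (bondPair (g j)).1 (bondPair (g j)).2 θ)
    (fun θ => cosDiff x' y' θ * ∏ j ∈ Finset.univ \ S, cosDiff (bondPair (g j)).1 (bondPair (g j)).2 θ)]
  have h1 : ∫ θ, cosDiff x y θ * ∏ j ∈ S, cosDiff (bondPair (g j)).1 (bondPair (g j)).2 θ ∂torusHaar V =
      (cnt g S x y : ℝ) / 2 ^ Fintype.card S := by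
    have hf : (fun θ : V → Circle => cosDiff x y θ * ∏ j ∈ S, cosDiff (bondPair (g j)).1 (bondPair (g j)).2 θ) =
        fun θ => cosDiff x y θ * ∏ j : S, cosDiff ((fun j : S => bondPair (g j)) j).1
          ((fun j : S => bondPair (g j)) j).2 θ := by
      funext θ
      rw [← Finset.prod_coe_sort S]
    rw [hf]
    exact integral_cosDiff_mul_prod_cosDiff x y (fun j : S => bondPair (g j))
  have h2 : ∫ θ, cosDiff x' y' θ * ∏ j ∈ Finset.univ \ S, cosDiff (bondPair (g j)).1 (bondPair (g j)).2 θ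
      ∂torusHaar V = (cntc g S x' y' : ℝ) / 2 ^ Fintype.card {j // j ∉ S} := by
    have hf : (fun θ : V → Circle =>
        cosDiff x' y' θ * ∏ j ∈ Finset.univ \ S, cosDiff (bondPair (g j)).1 (bondPair (g j)).2 θ) =
        fun θ => cosDiff x' y' θ * ∏ j : {j // j ∉ S}, cosDiff ((fun j : {j // j ∉ S} => bondPair (g j)) j).1
          ((fun j : {j // j ∉ S} => bondPair (g j)) j).2 θ := by
      funext θ
      rw [Finset.prod_subtype (p := fun j : Fin N => j ∉ S) (Finset.univ \ S) (fun j => by simp)]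
    rw [hf]
    exact integral_cosDiff_mul_prod_cosDiff x' y' (fun j : {j // j ∉ S} => bondPair (g j))
  rw [h1, h2, div_mul_div_comm, ← pow_add, Fintype.card_subtype_compl, Fintype.card_coe, Fintype.card_fin,
    Nat.add_sub_cancel' (S.card_le_univ.trans_eq (Fintype.card_fin N)), Nat.cast_mul]

/-- **The coefficient inequality for one word.** For a word `g` whose inside bonds have both endpoints in `A` and
whose `C`-bonds have both endpoints in `C`, `a ∈ A`, `c ∈ C`:
`∫∫ cos(θ_a − θ_c) ∏_j φ_{g j} ≤ ∫∫ (∑_{b ∈ A∩C} cos(θ'_a − θ'_b) cos(θ_b − θ_c)) ∏_j φ_{g j}` — after the splitting and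
the counting formula this is `lieb_orientation_count_le` divided by `2^N`. [cite: Lieb1980, eqs. (23)–(24), p. 133; Rivasseau1980 Lemma] -/
theorem integral_obs_prod_dupCos_le (A C : Finset V) (g : Fin N → (V × V) ⊕ (V × V))
    (hA : ∀ j ∈ insidePos g, (bondPair (g j)).1 ∈ A ∧ (bondPair (g j)).2 ∈ A)
    (hC : ∀ j, j ∉ insidePos g → (bondPair (g j)).1 ∈ C ∧ (bondPair (g j)).2 ∈ C)
    {a c : V} (ha : a ∈ A) (hc : c ∈ C) :
    ∫ z, cosDiff a c z.2 * ∏ j, dupCos (g j) z ∂((torusHaar V).prod (torusHaar V)) ≤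
      ∫ z, (∑ b ∈ A ∩ C, cosDiff a b z.1 * cosDiff b c z.2) * ∏ j, dupCos (g j) z
        ∂((torusHaar V).prod (torusHaar V)) := by
  -- both sides as sums over `S ⊆ insidePos g` of split terms
  have hL : (fun z : (V → Circle) × (V → Circle) => cosDiff a c z.2 * ∏ j, dupCos (g j) z) =
      fun z => ∑ S ∈ (insidePos g).powerset,
        (cosDiff a a z.1 * ∏ j ∈ S, cosDiff (bondPair (g j)).1 (bondPair (g j)).2 z.1) *
          (cosDiff a c z.2 * ∏ j ∈ Finset.univ \ S, cosDiff (bondPair (g j)).1 (bondPair (g j)).2 z.2) := by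
    funext z
    rw [prod_dupCos_eq_sum, Finset.mul_sum]
    exact Finset.sum_congr rfl fun S _ => by rw [cosDiff_self]; ring
  have hR : (fun z : (V → Circle) × (V → Circle) =>
      (∑ b ∈ A ∩ C, cosDiff a b z.1 * cosDiff b c z.2) * ∏ j, dupCos (g j) z) =
      fun z => ∑ b ∈ A ∩ C, ∑ S ∈ (insidePos g).powerset,
        (cosDiff a b z.1 * ∏ j ∈ S, cosDiff (bondPair (g j)).1 (bondPair (g j)).2 z.1) *
          (cosDiff b c z.2 * ∏ j ∈ Finset.univ \ S, cosDiff (bondPair (g j)).1 (bondPair (g j)).2 z.2) := by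
    funext z
    rw [prod_dupCos_eq_sum, Finset.sum_mul]
    refine Finset.sum_congr rfl fun b _ => ?_
    rw [Finset.mul_sum]
    exact Finset.sum_congr rfl fun S _ => by ring
  rw [hL, hR, integral_finsetSum _ fun S _ => integrable_dup (continuous_term g S a a a c),
    integral_finsetSum _ fun b _ => ?_]
  swap
  · exact (integrable_finsetSum _ fun S _ => integrable_dup (continuous_term g S a b b c))
  simp_rw [integral_finsetSum _ fun S _ => integrable_dup (continuous_term g S a _ _ c), integral_term_eq,
    ← Finset.sum_div]
  refine div_le_div_of_nonneg_right ?_ (by positivity)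
  have key := lieb_orientation_count_le (fun j => bondPair (g j)) (insidePos g) A C a c hA hC ha hc
  have e : ∀ S : Finset (Fin N), cnt g S a a = (Finset.univ.filter fun τ : S → Bool =>
      valence (orient (fun j : S => bondPair (g j)) τ) Finset.univ = 0).card := fun S => by
    simp only [cnt, sub_self]
  simp_rw [e]
  exact_mod_cast key

end Expansion

end PlaneRotator

end Literature.Probability.LatticeModels

end
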